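import Summits.HodgeConjecture.HodgeConjecture.Theorems.CyclicUnitaryPowersAndreExit
import Summits.HodgeConjecture.HodgeConjecture.Theorems.CyclicUnitaryPowersLaneDGlue
import Summits.HodgeConjecture.HodgeConjecture.Theorems.CyclicUnitaryPowersUnitaryDense
import HarnessLib

/-!
# Crux K1 `VeryGeneralDeckCommutatorsInHg` (route `CyclicUnitaryPowers`, stmt-HodgeConjecture-19544) CLOSED MODULO
# THE CITED FACTS: the commutators of two `σ`-unitary automorphisms of `H²` of a very general cyclic cover lie in `Hg`

The line `unitary-reflection-zariski` (registered skeleton v9, planner P3 g23) of the crux reduces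
`VeryGeneralDeckCommutatorsInHg` to cited published theorems (fact binders) and two theorem stubs.  Both theorem
stubs of lane D are now in the tree: the unitary-density fact UD is a theorem
(`CyclicUnitaryPowersUnitaryDense.stub_unitaryDense`, prover-A) and the glue `stub_unitaryCommutatorsInMon_of_facts :
CT71 → GKR' → UD → D` is a theorem (`CyclicUnitaryPowersLaneDGlue`, prover-Ax's assembly with prover-A's pieces).  This
file composes them with prover-Ax's exit `CyclicUnitaryPowersAndreExit.veryGeneralDeckCommutatorsInHg_of_andre`
(models → K1 by the landed transfer; Cattani–Deligne–Kaplan bad family; André's normality; `Mon ⊆ MT^der ⊆ Hg`):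
**the crux holds conditionally on exactly seven named facts of the Literature layer** —
`nonempty_carlsonToledoFamily`, `carlsonToledo1999_finrank_eigenspace_deck_one`,
`carlsonToledo1999_finrank_eigenspace_inf_hodgePiece`, `carlsonToledo1999_unitaryReflection_zariskiDense`
(Carlson–Toledo 1999), `cmsp_nonHodgeGenericPoints_countable_algebraic_cover` (Cattani–Deligne–Kaplan 1995),
`andre1992_algebraicMonodromy_normal_mumfordTateGroup` (André 1992), `Katz1990_goursatKolchinRibet_specialLinear'`
(Katz 1990) — each a `def … : Prop` with a locator, dischargeable independently (debt queue).  Written by the prover seat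
`hodge-nonav-prover-A` (g2).

## References
* [CarlsonToledo1999] J. A. Carlson, D. Toledo, Duke Math. J. 97 (1999), Theorem 7.1 and §§2–7.
* [Katz1990ESDE] N. M. Katz, Ann. of Math. Stud. 124 (1990), §1.8 Prop. 1.8.2.
* [Andre1992] Y. André, Compositio Math. 82 (1992), Theorem 1.
* [CattaniDeligneKaplan1995] E. Cattani, P. Deligne, A. Kaplan, J. Amer. Math. Soc. 8 (1995).
-/

noncomputable section

open Literature.AlgebraicGeometry.Motives Literature.AlgebraicGeometry.HodgeTheory

-- mandated namespace `Summit.HodgeConjecture.HodgeConjecture.Theorems` trips `linter.dupNamespace` (off tree-wide)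
set_option linter.dupNamespace false

namespace Summit.HodgeConjecture.HodgeConjecture.Theorems.CyclicUnitaryPowersVeryGeneralDeckCommutatorsInHg

/-- **Crux K1 `VeryGeneralDeckCommutatorsInHg` modulo the seven cited facts** (Carlson–Toledo ×4, Cattani–Deligne–Kaplan,
André, Katz): for a very general smooth member of the cyclic family, every commutator of two `σ`-unitary rational
automorphisms of `H²` lies in the Hodge group.  Composition of the landed lane-D glue
(`CyclicUnitaryPowersLaneDGlue.stub_unitaryCommutatorsInMon_of_facts`), the landed unitary-density theorem
(`CyclicUnitaryPowersUnitaryDense.stub_unitaryDense`) and the landed exit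
(`CyclicUnitaryPowersAndreExit.veryGeneralDeckCommutatorsInHg_of_andre`). [cite: CarlsonToledo1999, §7 Theorem 7.1 (p. 16)]
[cite: Katz1990ESDE, §1.8 Prop. 1.8.2] -/
theorem veryGeneralDeckCommutatorsInHg_of_facts
    (hCT : nonempty_carlsonToledoFamily) (hCT1 : carlsonToledo1999_finrank_eigenspace_deck_one)
    (hCT2 : carlsonToledo1999_finrank_eigenspace_inf_hodgePiece)
    (hCDK : cmsp_nonHodgeGenericPoints_countable_algebraic_cover)
    (hAndre : andre1992_algebraicMonodromy_normal_mumfordTateGroup)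
    (hCTd : carlsonToledo1999_unitaryReflection_zariskiDense) (hGKR : Katz1990_goursatKolchinRibet_specialLinear') :
    Summit.HodgeConjecture.HodgeConjecture.Theses.CyclicUnitaryPowers.VeryGeneralDeckCommutatorsInHg :=
  CyclicUnitaryPowersAndreExit.veryGeneralDeckCommutatorsInHg_of_andre @hCT @hCT1 @hCT2 @hCDK @hAndre
    @(CyclicUnitaryPowersLaneDGlue.stub_unitaryCommutatorsInMon_of_facts hCTd hGKR
      CyclicUnitaryPowersUnitaryDense.stub_unitaryDense)

end Summit.HodgeConjecture.HodgeConjecture.Theorems.CyclicUnitaryPowersVeryGeneralDeckCommutatorsInHg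

end
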